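import Summits.Ventures.PercRepro.RankLevelSetBiIndepContainSkew

/-! # RankLevelSetBiIndepContainSkewColoop — (CX*) AND (CX) THROUGH A COLOOP: THE CONTAIN-SET STATEMENTS OF
`M` FOLLOW FROM THOSE OF `M ∖ c` FOR A COLOOP `c`, INCLUDING THE CONTAIN-SETS THROUGH THE COLOOP (night-1 g30; dossier §42)

For a coloop `c` of `M` and `M' := M ＼ {c}` (on `#E − 1` elements), a set `Z ∋ c` is bi-independent in `M` iff
`Z ∖ {c}` is bi-independent in `M'` (`biIndep_coloop_mem`), and a set `Z ∌ c` is bi-independent in `M` iff it is in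
`M'` (`biIndep_coloop_notMem`): a coloop is a free element of every bi-independent partition. For the contain-`X`
profile `α^X_k = biContainCount M X k` this gives
* `c ∈ X`: `α^X_{k+1}(M) = α^{X ∖ {c}}_k(M')`, `α^X_0(M) = 0` (`biContainCount_coloop_mem`, `…_mem_zero`);
* `c ∉ X`: `α^X_{k+1}(M) = α^X_{k+1}(M') + α^X_k(M')`, `α^X_0(M) = α^X_0(M')` (`biContainCount_coloop_notMem`, `…_zero`).
The contain-sets AVOIDING `c` are the one-sided direct-sum case of `RankLevelSetBiIndepContainSkewSum` (the summand
`U_{1,1}` is trivially Mono); the contain-sets THROUGH `c` shift the profile of `M'` by one level, and the skew of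
`M` about `(#E − 1)/2` at `X ∋ c` is the skew of `M'` about `(#E' − 2)/2` at `X ∖ {c}` — half a step MORE than (CX*)
asks of `M'`; it follows from (CX*) AND (CX) of `M'` together (`α_k ≤ α_{k+1} ≤ α_{#E'−2−k}`: one monotone step, then the
reflection of `k + 1`). Hence **`biContainSkew_of_coloop : M.IsColoop c → BiContainSkew (M ＼ {c}) →`
`BiContainMono (M ＼ {c}) → BiContainSkew M`** and **`biContainMono_of_coloop`** (same hypotheses, conclusion
`BiContainMono M`). With `RankLevelSetBiIndepContainSkewParallel` (parallel pairs, loops) the pair of statements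
(CX*) ∧ (CX) is now decided on the LOOPLESS, COLOOPLESS, SIMPLE matroids. Nothing here asserts (CX*) or (CX); every
declaration has a docstring; imports: the cell's own modules and Mathlib only. Axioms: standard. -/

namespace PercRepro

open Set Matroid

variable {α : Type} (M : Matroid α) [M.Finite]

/-! ## Bi-independent sets through and avoiding a coloop -/

omit [M.Finite] in
/-- Independence is unchanged by removing a coloop. -/
lemma indep_sdiff_coloop_iff {c : α} (hc : M.IsColoop c) (I : Set α) : M.Indep (I \ {c}) ↔ M.Indep I :=
  sdiff_indep_iff_indep_of_subset_coloops (Set.singleton_subset_iff.mpr hc)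

omit [M.Finite] in
/-- For `c ∈ Z`, the complement of `Z ∖ {c}` in `E ∖ {c}` is the complement of `Z` in `E`. -/
lemma compl_sdiff_coloop_eq {c : α} {Z : Set α} (hcZ : c ∈ Z) : (M.E \ {c}) \ (Z \ {c}) = M.E \ Z := by
  ext x
  simp only [Set.mem_sdiff, Set.mem_singleton_iff, not_and, not_not]
  constructor
  · rintro ⟨⟨hxE, hxc⟩, hx⟩
    exact ⟨hxE, fun hxZ => hxc (hx hxZ)⟩
  · rintro ⟨hxE, hxZ⟩
    exact ⟨⟨hxE, fun hxc => hxZ (hxc ▸ hcZ)⟩, fun hxZ' => absurd hxZ' hxZ⟩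

omit [M.Finite] in
/-- For `c ∉ Z`, the complement of `Z` in `E` is the complement in `E ∖ {c}` with `c` added back. -/
lemma compl_eq_insert_coloop {c : α} (hcE : c ∈ M.E) {Z : Set α} (hcZ : c ∉ Z) :
    M.E \ Z = insert c ((M.E \ {c}) \ Z) := by
  ext x
  simp only [Set.mem_sdiff, Set.mem_insert_iff, Set.mem_singleton_iff]
  constructor
  · rintro ⟨hxE, hxZ⟩
    by_cases hxc : x = c
    · exact Or.inl hxc
    · exact Or.inr ⟨⟨hxE, hxc⟩, hxZ⟩
  · rintro (rfl | ⟨⟨hxE, -⟩, hxZ⟩)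
    · exact ⟨hcE, hcZ⟩
    · exact ⟨hxE, hxZ⟩

/-- **Through the coloop**: for `c ∈ Z`, `Z ∈ D_{k+1}(M) ↔ Z ∖ {c} ∈ D_k(M ＼ {c})`. -/
lemma biIndep_coloop_mem {c : α} (hc : M.IsColoop c) {k : ℕ} {Z : Set α} (hcZ : c ∈ Z) :
    Z ∈ biIndep M (k + 1) ↔ Z \ {c} ∈ biIndep (M ＼ {c}) k := by
  have hfin : Z.Finite → (Z \ {c}).ncard = Z.ncard - 1 := fun _ => Set.ncard_sdiff_singleton_of_mem hcZ
  simp only [biIndep, Set.mem_setOf_eq, delete_ground, deleteElem_indep_iff, compl_sdiff_coloop_eq M hcZ,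
    indep_sdiff_coloop_iff M hc]
  constructor
  · rintro ⟨hZE, hZc, hZ, hZc'⟩
    refine ⟨Set.sdiff_subset_sdiff_left hZE, ?_, ⟨hZ, fun h => h.2 rfl⟩, ⟨hZc', fun h => h.2 hcZ⟩⟩
    rw [hfin (M.ground_finite.subset hZE), hZc]
    rfl
  · rintro ⟨hZE, hZc, ⟨hZ, -⟩, ⟨hZc', -⟩⟩
    have hZE' : Z ⊆ M.E := fun x hx => by
      by_cases hxc : x = c
      · exact hxc ▸ hc.mem_ground
      · exact (hZE ⟨hx, hxc⟩).1
    refine ⟨hZE', ?_, hZ, hZc'⟩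
    have := hfin (M.ground_finite.subset hZE')
    rw [hZc] at this
    have hpos : 0 < Z.ncard := (Set.ncard_pos (M.ground_finite.subset hZE')).mpr ⟨c, hcZ⟩
    omega

omit [M.Finite] in
/-- **Avoiding the coloop**: for `c ∉ Z`, `Z ∈ D_k(M) ↔ Z ∈ D_k(M ＼ {c})`. -/
lemma biIndep_coloop_notMem {c : α} (hc : M.IsColoop c) {k : ℕ} {Z : Set α} (hcZ : c ∉ Z) :
    Z ∈ biIndep M k ↔ Z ∈ biIndep (M ＼ {c}) k := by
  simp only [biIndep, Set.mem_setOf_eq, delete_ground, deleteElem_indep_iff, compl_eq_insert_coloop M hc.mem_ground hcZ]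
  have hins : M.Indep (insert c ((M.E \ {c}) \ Z)) ↔ M.Indep ((M.E \ {c}) \ Z) := by
    rw [← indep_sdiff_coloop_iff M hc, Set.insert_sdiff_of_mem _ (Set.mem_singleton c),
      Set.sdiff_singleton_eq_self (fun h => h.1.2 rfl)]
  rw [hins]
  constructor
  · rintro ⟨hZE, hZc, hZ, hZc'⟩
    exact ⟨fun x hx => ⟨hZE hx, fun hxc => hcZ (hxc ▸ hx)⟩, hZc, ⟨hZ, hcZ⟩, ⟨hZc', fun h => h.1.2 rfl⟩⟩
  · rintro ⟨hZE, hZc, ⟨hZ, -⟩, ⟨hZc', -⟩⟩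
    exact ⟨fun x hx => (hZE hx).1, hZc, hZ, hZc'⟩

/-! ## The contain-`X` counts through a coloop -/

/-- **`X` through the coloop**: `α^X_{k+1}(M) = α^{X ∖ {c}}_k(M ＼ {c})` for `c ∈ X`. -/
lemma biContainCount_coloop_mem {c : α} (hc : M.IsColoop c) {X : Set α} (hcX : c ∈ X) (k : ℕ) :
    biContainCount M X (k + 1) = biContainCount (M ＼ {c}) (X \ {c}) k := by
  unfold biContainCount
  refine Set.ncard_congr (fun Z _ => Z \ {c}) ?_ ?_ ?_
  · rintro Z ⟨hZ, hXZ⟩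
    exact ⟨(biIndep_coloop_mem M hc (hXZ hcX)).mp hZ, Set.sdiff_subset_sdiff_left hXZ⟩
  · rintro Z Z' ⟨-, hXZ⟩ ⟨-, hXZ'⟩ hZZ'
    have h1 : insert c (Z \ {c}) = insert c (Z' \ {c}) := by rw [hZZ']
    rwa [Set.insert_sdiff_singleton, Set.insert_sdiff_singleton, Set.insert_eq_of_mem (hXZ hcX),
      Set.insert_eq_of_mem (hXZ' hcX)] at h1
  · rintro T ⟨hT, hXT⟩
    have hcT : c ∉ T := fun h => hT.1 h |>.2 rfl
    refine ⟨insert c T, ⟨?_, ?_⟩, ?_⟩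
    · rw [biIndep_coloop_mem M hc (Set.mem_insert c T), Set.insert_sdiff_of_mem _ (Set.mem_singleton c),
        Set.sdiff_singleton_eq_self hcT]
      exact hT
    · intro x hx
      by_cases hxc : x = c
      · exact hxc ▸ Set.mem_insert c T
      · exact Set.mem_insert_of_mem c (hXT ⟨hx, hxc⟩)
    · rw [Set.insert_sdiff_of_mem _ (Set.mem_singleton c), Set.sdiff_singleton_eq_self hcT]

/-- No bi-independent `0`-set contains a nonempty `X`. -/
lemma biContainCount_zero_of_mem {X : Set α} {c : α} (hcX : c ∈ X) : biContainCount M X 0 = 0 := by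
  unfold biContainCount
  rw [Set.ncard_eq_zero ((biIndep_finite M 0).subset (fun Z hZ => hZ.1))]
  ext Z
  simp only [Set.mem_setOf_eq, Set.mem_empty_iff_false, iff_false, not_and]
  rintro ⟨hZE, hZ0, -, -⟩ hXZ
  have hZ : Z = ∅ := (Set.ncard_eq_zero (M.ground_finite.subset hZE)).mp hZ0
  rw [hZ] at hXZ
  exact hXZ hcX

/-- **`X` avoiding the coloop**: `α^X_{k+1}(M) = α^X_{k+1}(M ＼ {c}) + α^X_k(M ＼ {c})` for `c ∉ X`. -/
lemma biContainCount_coloop_notMem {c : α} (hc : M.IsColoop c) {X : Set α} (hcX : c ∉ X) (k : ℕ) :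
    biContainCount M X (k + 1) = biContainCount (M ＼ {c}) X (k + 1) + biContainCount (M ＼ {c}) X k := by
  unfold biContainCount
  have hfin : {Z ∈ biIndep M (k + 1) | X ⊆ Z}.Finite := (biIndep_finite M (k + 1)).subset (fun Z hZ => hZ.1)
  have hsplit : {Z ∈ biIndep M (k + 1) | X ⊆ Z} =
      {Z ∈ biIndep M (k + 1) | X ⊆ Z ∧ c ∉ Z} ∪ {Z ∈ biIndep M (k + 1) | X ⊆ Z ∧ c ∈ Z} := by
    ext Z
    simp only [Set.mem_setOf_eq, Set.mem_union]
    tauto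
  have hdisj : Disjoint {Z ∈ biIndep M (k + 1) | X ⊆ Z ∧ c ∉ Z} {Z ∈ biIndep M (k + 1) | X ⊆ Z ∧ c ∈ Z} := by
    rw [Set.disjoint_left]
    rintro Z ⟨-, -, h1⟩ ⟨-, -, h2⟩
    exact h1 h2
  rw [hsplit, Set.ncard_union_eq hdisj (hfin.subset (by rw [hsplit]; exact Set.subset_union_left))
    (hfin.subset (by rw [hsplit]; exact Set.subset_union_right))]
  congr 1
  · -- avoiding `c`: the same sets in `M ＼ {c}`
    congr 1
    ext Z
    simp only [Set.mem_setOf_eq]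
    constructor
    · rintro ⟨hZ, hXZ, hcZ⟩
      exact ⟨(biIndep_coloop_notMem M hc hcZ).mp hZ, hXZ⟩
    · rintro ⟨hZ, hXZ⟩
      have hcZ : c ∉ Z := fun h => (hZ.1 h).2 rfl
      exact ⟨(biIndep_coloop_notMem M hc hcZ).mpr hZ, hXZ, hcZ⟩
  · -- through `c`: remove it
    refine Set.ncard_congr (fun Z _ => Z \ {c}) ?_ ?_ ?_
    · rintro Z ⟨hZ, hXZ, hcZ⟩
      refine ⟨(biIndep_coloop_mem M hc hcZ).mp hZ, ?_⟩
      intro x hx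
      exact ⟨hXZ hx, fun hxc => hcX (hxc ▸ hx)⟩
    · rintro Z Z' ⟨-, -, hcZ⟩ ⟨-, -, hcZ'⟩ hZZ'
      have h1 : insert c (Z \ {c}) = insert c (Z' \ {c}) := by rw [hZZ']
      rwa [Set.insert_sdiff_singleton, Set.insert_sdiff_singleton, Set.insert_eq_of_mem hcZ,
        Set.insert_eq_of_mem hcZ'] at h1
    · rintro T ⟨hT, hXT⟩
      have hcT : c ∉ T := fun h => hT.1 h |>.2 rfl
      refine ⟨insert c T, ⟨?_, hXT.trans (Set.subset_insert c T), Set.mem_insert c T⟩, ?_⟩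
      · rw [biIndep_coloop_mem M hc (Set.mem_insert c T), Set.insert_sdiff_of_mem _ (Set.mem_singleton c),
          Set.sdiff_singleton_eq_self hcT]
        exact hT
      · rw [Set.insert_sdiff_of_mem _ (Set.mem_singleton c), Set.sdiff_singleton_eq_self hcT]

/-- **Level `0`, `X` avoiding the coloop**: `α^X_0(M) = α^X_0(M ＼ {c})`. -/
lemma biContainCount_coloop_notMem_zero {c : α} (hc : M.IsColoop c) (X : Set α) :
    biContainCount M X 0 = biContainCount (M ＼ {c}) X 0 := by
  unfold biContainCount
  congr 1
  ext Z
  simp only [Set.mem_setOf_eq]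
  constructor
  · rintro ⟨hZ, hXZ⟩
    have hZ0 : Z = ∅ := (Set.ncard_eq_zero (M.ground_finite.subset hZ.1)).mp hZ.2.1
    exact ⟨(biIndep_coloop_notMem M hc (by rw [hZ0]; exact Set.notMem_empty c)).mp hZ, hXZ⟩
  · rintro ⟨hZ, hXZ⟩
    have hcZ : c ∉ Z := fun h => (hZ.1 h).2 rfl
    exact ⟨(biIndep_coloop_notMem M hc hcZ).mpr hZ, hXZ⟩

omit [M.Finite] in
/-- The ground set of `M ＼ {c}` has `#E − 1` elements for `c ∈ E`. -/
lemma ncard_ground_delete_coloop {c : α} (hc : M.IsColoop c) : (M ＼ {c}).E.ncard = M.E.ncard - 1 := by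
  rw [delete_ground, Set.ncard_sdiff_singleton_of_mem hc.mem_ground]

omit [M.Finite] in
/-- For `X ⊆ E`, `X ∖ {c}` lies in the ground set of `M ＼ {c}`. -/
lemma sdiff_subset_delete_ground {X : Set α} (hX : X ⊆ M.E) (c : α) : X \ {c} ⊆ (M ＼ {c}).E := by
  rw [delete_ground]
  exact Set.sdiff_subset_sdiff_left hX

omit [M.Finite] in
/-- For `X ⊆ E` avoiding `c`, `X` lies in the ground set of `M ＼ {c}`. -/
lemma subset_delete_ground_of_notMem {X : Set α} (hX : X ⊆ M.E) {c : α} (hcX : c ∉ X) :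
    X ⊆ (M ＼ {c}).E := by
  rw [delete_ground]
  exact fun x hx => ⟨hX hx, fun hxc => hcX (hxc ▸ hx)⟩

/-! ## (CX*) and (CX) through a coloop -/

/-- **THE REDUCTION FOR (CX*)**: if `M ＼ {c}` satisfies (CX*) and (CX) for a coloop `c`, then `M` satisfies (CX*). -/
theorem biContainSkew_of_coloop {c : α} (hc : M.IsColoop c) (h1 : BiContainSkew (M ＼ {c}))
    (h2 : BiContainMono (M ＼ {c})) : BiContainSkew M := by
  intro X hX k hk
  have hn := ncard_ground_delete_coloop M hc
  have hE1 : 0 < M.E.ncard := (Set.ncard_pos M.ground_finite).mpr ⟨c, hc.mem_ground⟩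
  by_cases hcX : c ∈ X
  · rcases k with _ | r
    · rw [biContainCount_zero_of_mem M hcX]
      exact Nat.zero_le _
    · have hidx : M.E.ncard - 1 - (r + 1) = (M.E.ncard - 3 - r) + 1 := by omega
      rw [hidx, biContainCount_coloop_mem M hc hcX, biContainCount_coloop_mem M hc hcX]
      have hX' := sdiff_subset_delete_ground M hX c
      have hcx : biContainCount (M ＼ {c}) (X \ {c}) r ≤ biContainCount (M ＼ {c}) (X \ {c}) (r + 1) :=
        h2 (X \ {c}) hX' r (by rw [hn]; omega)
      by_cases hmid : 2 * (r + 1) + 1 < (M ＼ {c}).E.ncard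
      · have := h1 (X \ {c}) hX' (r + 1) hmid
        rw [hn] at this
        have hidx2 : M.E.ncard - 1 - 1 - (r + 1) = M.E.ncard - 3 - r := by omega
        rw [hidx2] at this
        exact hcx.trans this
      · have hidx3 : M.E.ncard - 3 - r = r + 1 := by rw [hn] at hmid; omega
        rw [hidx3]
        exact hcx
  · have hX' := subset_delete_ground_of_notMem M hX hcX
    rcases k with _ | r
    · -- level `0`: `α'_0 ≤ α'_{n'} + α'_{n'−1}`
      rw [biContainCount_coloop_notMem_zero M hc]
      have hidx : M.E.ncard - 1 - 0 = (M.E.ncard - 2) + 1 := by omega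
      rw [hidx, biContainCount_coloop_notMem M hc hcX]
      by_cases h2E : 1 < (M ＼ {c}).E.ncard
      · have := h1 X hX' 0 h2E
        rw [hn] at this
        have hidx2 : M.E.ncard - 1 - 1 - 0 = M.E.ncard - 2 := by omega
        rw [hidx2] at this
        omega
      · have h0 : M.E.ncard - 2 = 0 := by rw [hn] at h2E; omega
        rw [h0]
        omega
    · -- level `r + 1`: `α'_{r+1} + α'_r ≤ α'_{n'−1−r} + α'_{n'−2−r}` termwise
      have hidx : M.E.ncard - 1 - (r + 1) = (M.E.ncard - 3 - r) + 1 := by omega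
      rw [hidx, biContainCount_coloop_notMem M hc hcX, biContainCount_coloop_notMem M hc hcX]
      have hA : biContainCount (M ＼ {c}) X r ≤ biContainCount (M ＼ {c}) X (M.E.ncard - 3 - r + 1) := by
        have := h1 X hX' r (by rw [hn]; omega)
        rw [hn] at this
        have hidx2 : M.E.ncard - 1 - 1 - r = M.E.ncard - 3 - r + 1 := by omega
        rwa [hidx2] at this
      have hB : biContainCount (M ＼ {c}) X (r + 1) ≤ biContainCount (M ＼ {c}) X (M.E.ncard - 3 - r) := by
        by_cases hmid : 2 * (r + 1) + 1 < (M ＼ {c}).E.ncard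
        · have h'' := h1 X hX' (r + 1) hmid
          rw [hn] at h''
          have hidx3 : M.E.ncard - 1 - 1 - (r + 1) = M.E.ncard - 3 - r := by omega
          rwa [hidx3] at h''
        · have hidx3 : M.E.ncard - 3 - r = r + 1 := by rw [hn] at hmid; omega
          rw [hidx3]
      omega

/-- **THE REDUCTION FOR (CX)**: if `M ＼ {c}` satisfies (CX*) and (CX) for a coloop `c`, then `M` satisfies (CX). -/
theorem biContainMono_of_coloop {c : α} (hc : M.IsColoop c) (h1 : BiContainSkew (M ＼ {c}))
    (h2 : BiContainMono (M ＼ {c})) : BiContainMono M := by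
  intro X hX k hk
  have hn := ncard_ground_delete_coloop M hc
  have hE1 : 0 < M.E.ncard := (Set.ncard_pos M.ground_finite).mpr ⟨c, hc.mem_ground⟩
  by_cases hcX : c ∈ X
  · rcases k with _ | r
    · rw [biContainCount_zero_of_mem M hcX]
      exact Nat.zero_le _
    · rw [biContainCount_coloop_mem M hc hcX, biContainCount_coloop_mem M hc hcX]
      exact h2 (X \ {c}) (sdiff_subset_delete_ground M hX c) r (by rw [hn]; omega)
  · have hX' := subset_delete_ground_of_notMem M hX hcX
    rcases k with _ | r
    · rw [biContainCount_coloop_notMem_zero M hc, biContainCount_coloop_notMem M hc hcX]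
      omega
    · rw [biContainCount_coloop_notMem M hc hcX, biContainCount_coloop_notMem M hc hcX]
      -- need `α'_r ≤ α'_{r+2}`
      have hstep : biContainCount (M ＼ {c}) X r ≤ biContainCount (M ＼ {c}) X (r + 1 + 1) := by
        by_cases h22 : 2 * (r + 1 + 1) ≤ (M ＼ {c}).E.ncard
        · exact (h2 X hX' r (by omega)).trans (h2 X hX' (r + 1) h22)
        · -- the middle of an odd `#E'`: `r + 2 = #E' − 1 − r`, so (CX*) at `r` gives it
          have := h1 X hX' r (by rw [hn]; omega)
          have hidx : (M ＼ {c}).E.ncard - 1 - r = r + 1 + 1 := by rw [hn] at h22 ⊢; omega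
          rwa [hidx] at this
      omega

end PercRepro
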